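import Summits.AtomisticToContinuum.FouriersLaw.Theses.CageBudgetFekete
import Summits.AtomisticToContinuum.FouriersLaw.Theorems.CageBudgetFeketeHeatVarianceCalculus
import Summits.AtomisticToContinuum.FouriersLaw.Theorems.CurrentTiltQuenchSymmetricSetup
import Summits.AtomisticToContinuum.FouriersLaw.Theorems.HeatVarianceCeiling.Negative.Rigidity
import Literature.MathematicalPhysics.KineticTheory.InfiniteChainShiftInvariantUniqueness
import HarnessLib

/-!
# `CageBudgetFekete.UnboundedHeatVariance`, line Sketch — canonical reduction (edge "R")

Support file (`--supports stmt-AtomisticToContinuum-15771`) for the stub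
`stub_unboundedHeatVariance_iff_exists` of line `Sketch`.

The crux `U = UnboundedHeatVariance` quantifies over EVERY guarded pair `(μ_T, D)` of the pinned chain
`pinnedChain ω₂ lam β γ` (`ω₂, lam, β > 0`, `T > 0`) with absolutely convergent and continuous summed current
correlation `C_T`, and asks that the heat variance `V_T(τ) = 2∫_{(0,τ]}(τ-s)C_T(s)ds` be unbounded above.
This file certifies that `U` is a property of the parameter point `(ω₂, lam, β, γ, T)` alone:

* (in tree, reused) `HeatVarianceCeiling.Negative.heatVariance_eq_of_preservesMeasure` — any two dynamics
  preserving the (unique) shift-invariant DLR state have the same summed current correlation, hence the same heat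
  variance: both are `μ_T`-a.e. equal, at all times, to the canonical Buttà–Marchioro dynamics
  (`HeatVarianceCalculus.CanonicalRigidity.flow_ae_eq_canonical`).
* `stub_unboundedHeatVariance_iff_exists` — `U ↔ ∃`-form: at every parameter point SOME guarded pair has unbounded
  heat variance. (→) the guarded pair of `cageBudgetFekete_symmetricSetup_proof`, whose `C_T` is absolutely
  convergent and continuous by `heatVarianceCalculus_proof`; (←) DLR uniqueness in the shift-invariant class
  (`eq_of_isChainGibbsMeasure_of_isShiftInvariant_pinnedChain`) and dynamics rigidity identify the two `V_T`'s.
* `unboundedHeatVariance_iff_dropRegularity` — rider: the two regularity hypotheses of `U` are idle.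
-/

noncomputable section

namespace Summit.AtomisticToContinuum.FouriersLaw.Theorems.UnboundedHeatVariance.Sketch

open MeasureTheory Set Filter Topology
open Literature.MathematicalPhysics.KineticTheory.HeatConduction

/-- **Rider: the regularity hypotheses of `U` are idle.** `UnboundedHeatVariance` is equivalent to the same
statement with the hypotheses "`C_T` absolutely convergent at every `t`" and "`C_T` continuous" deleted, because
`heatVarianceCalculus_proof` supplies both for every guarded pair. [folklore] -/
theorem unboundedHeatVariance_iff_dropRegularity :
    (_root_.Summit.AtomisticToContinuum.FouriersLaw.Theses.CageBudgetFekete.UnboundedHeatVariance ↔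
      (∀ ω₂ lam β γ : ℝ, 0 < ω₂ → 0 < lam → 0 < β → ∀ T : ℝ, 0 < T →
        ∀ μ : MeasureTheory.Measure ChainConfig, (pinnedChain ω₂ lam β γ).IsChainGibbsMeasure T μ →
        IsShiftInvariant μ → μ.map (fun σ : ChainConfig => fun x : ℤ => ((σ x).1, -(σ x).2)) = μ →
        ∀ D : InfiniteChainDynamics (pinnedChain ω₂ lam β γ), D.PreservesMeasure μ →
        (∀ t : ℝ, ∀ᵐ σ ∂μ, D.flow t (shift σ) = shift (D.flow t σ)) →
        ∀ V : ℝ → ℝ, V = (fun τ : ℝ => 2 * ∫ s in Set.Ioc (0:ℝ) τ, (τ - s) * D.currentCorrelation μ s) →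
        ∀ R : ℝ, ∃ τ : ℝ, 0 ≤ τ ∧ R < V τ)) := by
  refine ⟨fun hU ω₂ lam β γ hω hl hβ T hT μ hG hSI hRefl D hP hShift V hV => ?_,
    fun h ω₂ lam β γ hω hl hβ T hT μ hG hSI hRefl D hP hShift _ _ V hV => ?_⟩
  · obtain ⟨hAC, hCc, -⟩ := HeatVarianceCalculus.CanonicalRigidity.heatVarianceCalculus_proof
      ω₂ lam β γ hω hl hβ T hT μ hG hSI hRefl D hP hShift
    exact hU ω₂ lam β γ hω hl hβ T hT μ hG hSI hRefl D hP hShift hAC hCc V hV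
  · exact h ω₂ lam β γ hω hl hβ T hT μ hG hSI hRefl D hP hShift V hV

/-- **Canonical reduction (edge "R").** The crux `UnboundedHeatVariance` — unbounded heat variance for EVERY
guarded pair `(μ_T, D)` with regular `C_T` — is equivalent to: at every parameter point `(ω₂, lam, β, γ, T)`
SOME guarded pair has unbounded heat variance `2∫_{(0,τ]}(τ-s)C_T(s)ds`.
(→) the guarded pair of `cageBudgetFekete_symmetricSetup_proof`; its `C_T` is absolutely convergent and
continuous by `heatVarianceCalculus_proof`. (←) the shift-invariant DLR state is unique
(`eq_of_isChainGibbsMeasure_of_isShiftInvariant_pinnedChain`), and by dynamics rigidity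
(`HeatVarianceCeiling.Negative.heatVariance_eq_of_preservesMeasure`) any two `μ_T`-preserving dynamics have the
same `C_T`, hence the same heat variance. [folklore] -/
theorem stub_unboundedHeatVariance_iff_exists :
    (_root_.Summit.AtomisticToContinuum.FouriersLaw.Theses.CageBudgetFekete.UnboundedHeatVariance ↔ (∀ ω₂ lam β γ : ℝ, 0 < ω₂ → 0 < lam → 0 < β → ∀ T : ℝ, 0 < T → ∃ μ : MeasureTheory.Measure Literature.MathematicalPhysics.KineticTheory.HeatConduction.ChainConfig, (Literature.MathematicalPhysics.KineticTheory.HeatConduction.pinnedChain ω₂ lam β γ).IsChainGibbsMeasure T μ ∧ Literature.MathematicalPhysics.KineticTheory.HeatConduction.IsShiftInvariant μ ∧ μ.map (fun σ : Literature.MathematicalPhysics.KineticTheory.HeatConduction.ChainConfig => fun x : ℤ => ((σ x).1, -(σ x).2)) = μ ∧ ∃ D : Literature.MathematicalPhysics.KineticTheory.HeatConduction.InfiniteChainDynamics (Literature.MathematicalPhysics.KineticTheory.HeatConduction.pinnedChain ω₂ lam β γ), D.PreservesMeasure μ ∧ (∀ t : ℝ, ∀ᵐ σ ∂μ, D.flow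 t (Literature.MathematicalPhysics.KineticTheory.HeatConduction.shift σ) = Literature.MathematicalPhysics.KineticTheory.HeatConduction.shift (D.flow t σ)) ∧ ∀ R : ℝ, ∃ τ : ℝ, 0 ≤ τ ∧ R < 2 * ∫ s in Set.Ioc (0:ℝ) τ, (τ - s) * D.currentCorrelation μ s)) := by
  refine ⟨fun hU ω₂ lam β γ hω hl hβ T hT => ?_, fun h ω₂ lam β γ hω hl hβ T hT μ hG hSI hRefl D hP hShift _ _ V hV => ?_⟩
  · obtain ⟨μ, hG, hSI, hRefl, D, hP, hShift⟩ :=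
      CurrentTiltQuench.cageBudgetFekete_symmetricSetup_proof ω₂ lam β γ hω hl hβ T hT
    obtain ⟨hAC, hCc, -⟩ := HeatVarianceCalculus.CanonicalRigidity.heatVarianceCalculus_proof
      ω₂ lam β γ hω hl hβ T hT μ hG hSI hRefl D hP hShift
    exact ⟨μ, hG, hSI, hRefl, D, hP, hShift,
      hU ω₂ lam β γ hω hl hβ T hT μ hG hSI hRefl D hP hShift hAC hCc _ rfl⟩
  · obtain ⟨μ', hG', hSI', -, D', hP', -, hR⟩ := h ω₂ lam β γ hω hl hβ T hT
    have hμ : μ' = μ :=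
      OscillatorChain.eq_of_isChainGibbsMeasure_of_isShiftInvariant_pinnedChain γ hω hl.le hβ.le hT hG' hSI' hG hSI
    subst hμ
    intro R
    obtain ⟨τ, hτ, hRτ⟩ := hR R
    refine ⟨τ, hτ, ?_⟩
    rw [hV]
    show R < 2 * ∫ s in Set.Ioc (0:ℝ) τ, (τ - s) * D.currentCorrelation μ' s
    rw [← HeatVarianceCeiling.Negative.heatVariance_eq_of_preservesMeasure γ hω hl hβ hT hG hSI D' D hP' hP τ]
    exact hRτ

end Summit.AtomisticToContinuum.FouriersLaw.Theorems.UnboundedHeatVariance.Sketch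

end
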